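import Summits.BirchSwinnertonDyer.BirchSwinnertonDyer.Theses.KolyvaginRankRigidityAtTwo
import Literature.NumberTheory.EllipticCurves.BSDHeegnerPointsModularityOnlyProofs
import Literature.NumberTheory.EllipticCurves.HeegnerPointsOfConductorOneGaloisConjProofs
import HarnessLib

/-!
# Route `KolyvaginRankRigidityAtTwo`, support `PrintedInputsRankOneAtTwo`
# (stmt-BirchSwinnertonDyer-23951): reduction to the tree's named facts

The support item is the conjunction of seven printed inputs at `p = 2`. Two of its conjuncts are
THEOREMS of the tree — Shimura reciprocity at conductor `1`
(`heegnerPointOfConductor_one_galoisConj_holds`, Darmon 2004 Thm. 3.7 / Gross 1991 §4) and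
Gross–Zagier in the form «`ord_{s=1} L(E/K, s) = 1 ↔ y_K` non-torsion» modulo the Gross–Zagier
FORMULA and Modularity (`analyticRankEK_eq_one_iff_heegner_nonTorsion_of_exists_isNewformOf`).
The other five are statement-only named facts of the tree (none has a `_holds`): Modularity
(`ModularForms.exists_isNewformOf`, BCDT 2001), Hoffstein–Luo 1997, 2-parity
(`p_parity · 2`, Dokchitser–Dokchitser 2010 Thm. 1.4 + Monsky), Kolyvagin–Kato finiteness at `2`
(`kato_finite_of_L_one_ne_zero · 2`) and `hasEntireLFunction_rat`; with the Gross–Zagier formula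
`gross_zagier` that makes six.

This file proves the CONDITIONAL reduction `printedInputsRankOneAtTwo_of_facts`: the six named
facts imply the item. HONEST FRAMING (D-0014): conditional on six undischarged published facts; it
does not close the item by name and BSD is not proved by this file.
-/

set_option autoImplicit false
-- the Theorems namespace of this sub repeats the summit name by design (D-0017 nested layout)
set_option linter.dupNamespace false

noncomputable section

open scoped Classical

open WeierstrassCurve Literature.NumberTheory.EllipticCurves
  Literature.NumberTheory.EllipticCurves.ModularForms

namespace Summit.BirchSwinnertonDyer.BirchSwinnertonDyer.Theorems.KolyvaginRankRigidity

/-- **`PrintedInputsRankOneAtTwo` from six named facts of the tree** (Modularity, Hoffstein–Luo,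
2-parity, Kolyvagin–Kato finiteness at `2`, entire continuation of `L(E, s)`, the Gross–Zagier
formula): the reciprocity conjunct is the tree theorem `heegnerPointOfConductor_one_galoisConj_holds`
and the Gross–Zagier conjunct is `analyticRankEK_eq_one_iff_heegner_nonTorsion_of_exists_isNewformOf`.
Conditional result (D-0014). -/
theorem printedInputsRankOneAtTwo_of_facts (hmod : exists_isNewformOf)
    (hHL : HoffsteinLuo1997_exists_twist_L_one_ne_zero)
    (hpar : ∀ (V : WeierstrassCurve ℚ) [V.IsElliptic], p_parity V 2)
    (hKato : ∀ (V : WeierstrassCurve ℚ) [V.IsElliptic], kato_finite_of_L_one_ne_zero V 2)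
    (hE : WeierstrassCurve.hasEntireLFunction_rat)
    (hGZ : ∀ (N : ℕ) [NeZero N] (V : WeierstrassCurve ℚ) (K : Type) [Field K] [NumberField K],
      gross_zagier N V K) :
    Summit.BirchSwinnertonDyer.BirchSwinnertonDyer.Theses.KolyvaginRankRigidityAtTwo.PrintedInputsRankOneAtTwo := by
  unfold Summit.BirchSwinnertonDyer.BirchSwinnertonDyer.Theses.KolyvaginRankRigidityAtTwo.PrintedInputsRankOneAtTwo
  refine ⟨hmod, hHL, hpar, hKato, hE, fun V N _ K _ _ ↦ ?_, fun N _ V K _ _ ↦ ?_⟩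
  · exact analyticRankEK_eq_one_iff_heegner_nonTorsion_of_exists_isNewformOf V N K (hGZ N V K) hmod
  · exact heegnerPointOfConductor_one_galoisConj_holds N V K

end Summit.BirchSwinnertonDyer.BirchSwinnertonDyer.Theorems.KolyvaginRankRigidity
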